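import Literature.AlgebraicGeometry.Motives.HodgeThetaSubalgebraUnitarySlotIdentity
import HarnessLib

/-!
# From the slot identity to scalars on the range: `Y X†` acts on `Y(W)` as the scalar `λ(X, Y)`

Family `hodge`, layer `Literature/AlgebraicGeometry/Motives` (pure linear algebra over `ℂ`; no geometry). Research
context: cell `pub-hodge-ring2` (HONEST FRAMING: research route conditional on HC_CM; not a corollary; Q11.4-sentence-2
already refuted in dim ≥ 3), Literature lane gen 87 — step 3 of the proof plan for the last `p = 37` cell `(15 | 22)`
of Ribet's theorem (`HodgeThetaSubalgebraUnitaryFifteenTwentyTwoReduction`, plan in the gen-87 README; step 2 is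
`HodgeThetaSubalgebraUnitarySlotIdentity`). UNCONDITIONAL; theorems only, no definition, no named fact (D-0026), no
`sorry`.

THE STATEMENT. Notation of `UnitaryLeviSetup.slot_identity`: `B` raising with involution `ι`, pieces `U± `,
`Q ∩ U⁺`, `B(W)`; `Y` raising commuting with `ι`, of profile `(i, j)` with `i + j = rk B` and `i < j`, adjoint `Y†`;
`X` raising commuting with `ι`, adjoint `X†`. If `Y Y† B + B Y† Y = μ B` and `Y X† B + B X† Y = λ B` then: `μ ≠ 0`
(otherwise `Y†` kills `B(ker Y|_{Q∩U⁺})`, a subspace of `B(W)` of dimension `rk B − i > rk B − j` meeting `Y(U⁻)` in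
an isotropic vector); `B(ker Y|_{Q∩U⁺}) = Y(U⁻)`; and **`Y X† = λ` on `Y(U⁻)` and on `Y(U⁺)`**.
[cite: GoodmanWallachGTM255, §4.1.1] [cite: Deligne1982HodgeCycles, I §3 Prop. 3.4, 3.6]
[cite: HoffmanKunze1971LinearAlgebra, §8.5, §3.1 Thm. 2]

## References
* [GoodmanWallachGTM255] R. Goodman, N. R. Wallach, GTM 255 (2009), §4.1.1.
* [Deligne1982HodgeCycles] P. Deligne, *Hodge cycles on abelian varieties*, LNM 900 (1982), I §3 Prop. 3.4, 3.6.
* [HoffmanKunze1971LinearAlgebra] K. Hoffman, R. Kunze, *Linear Algebra* (1971), §8.5, §3.1 Thm. 2.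
-/

noncomputable section

open Module

namespace Literature.AlgebraicGeometry.Motives

namespace HodgeStructure

universe u

variable {W : Type u} [AddCommGroup W] [Module ℂ W]

/-- **Scalars on the range.** See the module docstring. [cite: GoodmanWallachGTM255, §4.1.1]
[cite: Deligne1982HodgeCycles, I §3 Prop. 3.4, 3.6] [cite: HoffmanKunze1971LinearAlgebra, §8.5, §3.1 Thm. 2] -/
theorem UnitaryLeviSetup.scalar_on_range [FiniteDimensional ℂ W] {Θ : Module.End ℂ W} (hΘΘ : Θ * Θ = 1)
    {P Q : Submodule ℂ W} (hP : ∀ x, x ∈ P ↔ Θ x = x) (hQ : ∀ x, x ∈ Q ↔ Θ x = -x)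
    {s : W → W → ℂ} (hadd : ∀ x y z, s (x + y) z = s x z + s y z) (hsymm : ∀ x y, s y x = starRingEnd ℂ (s x y))
    (hPQ : ∀ p ∈ P, ∀ q ∈ Q, s p q = 0) (hdefP : ∀ p ∈ P, s p p = 0 → p = 0) (hdefQ : ∀ q ∈ Q, s q q = 0 → q = 0)
    {B : Module.End ℂ W}
    {ι : Module.End ℂ W} {Um Up QU : Submodule ℂ W} (hιι : ι * ι = 1) (hιΘ : ι * Θ = Θ * ι)
    (hιs : ∀ x y, s (ι x) y = s x (ι y)) (hUm : ∀ x, x ∈ Um ↔ ι x = -x) (hUp : ∀ x, x ∈ Up ↔ ι x = x)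
    (hPM : ∀ x, x ∈ LinearMap.range B ↔ ι x = -x ∧ Θ x = x)
    (hQM : ∀ x, x ∈ Q ⊓ LinearMap.ker B ↔ ι x = -x ∧ Θ x = -x) (hQU : ∀ x, x ∈ QU ↔ ι x = x ∧ Θ x = -x)
    (hfinQU : Module.finrank ℂ QU = Module.finrank ℂ (LinearMap.range B))
    {Y Ya X Xa : Module.End ℂ W} (hΘY : Θ * Y = Y) (hYΘ : Y * Θ = -Y) (hYc : Y * ι = ι * Y)
    (hYYa : ∀ x y, s (Y x) y = s x (Ya y))
    (hΘX : Θ * X = X) (hXΘ : X * Θ = -X) (hXc : X * ι = ι * X) (hXXa : ∀ x y, s (X x) y = s x (Xa y))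
    {μ c : ℂ} (hYY : Y * Ya * B + B * Ya * Y = μ • B) (hXY : Y * Xa * B + B * Xa * Y = c • B)
    (hsum : Module.finrank ℂ (Up.map Y) + Module.finrank ℂ (Um.map Y) = Module.finrank ℂ (LinearMap.range B))
    (hij : Module.finrank ℂ (Up.map Y) < Module.finrank ℂ (Um.map Y)) :
    μ ≠ 0 ∧ (∀ p ∈ Um.map Y, Y (Xa p) = c • p) ∧ (∀ v ∈ Up.map Y, Y (Xa v) = c • v) := by
  classical
  obtain ⟨-, h0r, -, -, -, -, -⟩ := UnitaryTwoOdd.herm_right hadd hsymm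
  have hΘΘv : ∀ v, Θ (Θ v) = v := fun v => by rw [← Module.End.mul_apply, hΘΘ, Module.End.one_apply]
  have hιιv : ∀ v, ι (ι v) = v := fun v => by rw [← Module.End.mul_apply, hιι, Module.End.one_apply]
  have hΘι : ∀ v, Θ (ι v) = ι (Θ v) := fun v => by rw [← Module.End.mul_apply, ← hιΘ, Module.End.mul_apply]
  obtain ⟨hΘYa, -, hYac, hYaY⟩ := UnitaryLeviSetup.adj_raise hΘΘ hP hQ hadd hsymm hPQ hdefP hdefQ hιs hΘY hYΘ hYc hYYa
  obtain ⟨hΘXa, -, hXac, -⟩ := UnitaryLeviSetup.adj_raise hΘΘ hP hQ hadd hsymm hPQ hdefP hdefQ hιs hΘX hXΘ hXc hXXa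
  have hYι : ∀ v, Y (ι v) = ι (Y v) := fun v => by rw [← Module.End.mul_apply, hYc, Module.End.mul_apply]
  have hYaι : ∀ v, Ya (ι v) = ι (Ya v) := fun v => by rw [← Module.End.mul_apply, hYac, Module.End.mul_apply]
  have hXaι : ∀ v, Xa (ι v) = ι (Xa v) := fun v => by rw [← Module.End.mul_apply, hXac, Module.End.mul_apply]
  have hΘYv : ∀ w, Θ (Y w) = Y w := fun w => by rw [← Module.End.mul_apply, hΘY]
  have hΘYav : ∀ w, Θ (Ya w) = -(Ya w) := fun w => by rw [← Module.End.mul_apply, hΘYa, LinearMap.neg_apply]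
  have hΘXav : ∀ w, Θ (Xa w) = -(Xa w) := fun w => by rw [← Module.End.mul_apply, hΘXa, LinearMap.neg_apply]
  have hkillP : ∀ {Z : Module.End ℂ W}, Z * Θ = -Z → ∀ p, Θ p = p → Z p = 0 := by
    intro Z hZ p hp
    have h : Z p = -(Z p) := by
      conv_lhs => rw [← hp, ← Module.End.mul_apply, hZ, LinearMap.neg_apply]
    have h2 : (2 : ℂ) • Z p = 0 := by rw [two_smul]; nth_rewrite 2 [h]; rw [add_neg_cancel]
    exact (smul_eq_zero.1 h2).resolve_left two_ne_zero
  have hBinj : ∀ a ∈ QU, B a = 0 → a = 0 := by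
    intro a ha hBa
    obtain ⟨hιa, hΘa⟩ := (hQU a).1 ha
    have hmem : a ∈ Q ⊓ LinearMap.ker B := Submodule.mem_inf.2 ⟨(hQ a).2 hΘa, LinearMap.mem_ker.2 hBa⟩
    obtain ⟨hιa', -⟩ := (hQM a).1 hmem
    rw [hιa] at hιa'
    have h2 : (2 : ℂ) • a = 0 := by rw [two_smul]; nth_rewrite 2 [hιa']; rw [add_neg_cancel]
    exact (smul_eq_zero.1 h2).resolve_left two_ne_zero
  -- `Y(U⁺) = Y(Q ∩ U⁺)` and `Y(U⁻) ⊆ B(W)`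
  have hmapUp : Up.map Y = QU.map Y := by
    refine le_antisymm ?_ (Submodule.map_mono fun x hx => (hUp x).2 ((hQU x).1 hx).1)
    rintro _ ⟨v, hv, rfl⟩
    have hιv := (hUp v).1 hv
    have hv' : v = (2 : ℂ)⁻¹ • (v + Θ v) + (2 : ℂ)⁻¹ • (v - Θ v) := by module
    have hvP : Θ ((2 : ℂ)⁻¹ • (v + Θ v)) = (2 : ℂ)⁻¹ • (v + Θ v) := by rw [map_smul, map_add, hΘΘv, add_comm]
    have hvQ : (2 : ℂ)⁻¹ • (v - Θ v) ∈ QU := (hQU _).2 ⟨by rw [map_smul, map_sub, ← hΘι, hιv], by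
      rw [map_smul, map_sub, hΘΘv, ← smul_neg, neg_sub]⟩
    refine ⟨_, hvQ, ?_⟩
    conv_rhs => rw [hv', map_add, hkillP hYΘ _ hvP, zero_add]
  have hVle : Um.map Y ≤ LinearMap.range B := by
    rintro _ ⟨u, hu, rfl⟩
    exact (hPM _).2 ⟨by rw [← hYι, (hUm u).1 hu, map_neg], hΘYv u⟩
  -- `N = ker Y|_{Q ∩ U⁺}` as a subspace of `W`, and its dimension
  set N : Submodule ℂ W := (LinearMap.ker (Y.domRestrict QU)).map QU.subtype with hN
  have hNmem : ∀ x, x ∈ N ↔ x ∈ QU ∧ Y x = 0 := by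
    intro x
    constructor
    · rintro ⟨v, hv, rfl⟩
      exact ⟨v.2, by simpa [LinearMap.mem_ker, LinearMap.domRestrict_apply] using hv⟩
    · rintro ⟨hx, hYx⟩
      exact ⟨⟨x, hx⟩, by simpa [LinearMap.mem_ker, LinearMap.domRestrict_apply] using hYx, rfl⟩
  have hfinN : Module.finrank ℂ N + Module.finrank ℂ (Up.map Y) = Module.finrank ℂ (LinearMap.range B) := by
    have h := LinearMap.finrank_range_add_finrank_ker (Y.domRestrict QU)
    rw [LinearMap.range_domRestrict] at h
    rw [hN, Submodule.finrank_map_subtype_eq, hmapUp, ← hfinQU]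
    omega
  have hfinNB : Module.finrank ℂ (N.map B) = Module.finrank ℂ N := by
    have h := LinearMap.finrank_range_add_finrank_ker (B.domRestrict N)
    rw [LinearMap.range_domRestrict] at h
    have hk0 : LinearMap.ker (B.domRestrict N) = ⊥ := by
      refine (Submodule.eq_bot_iff _).2 fun v hv => ?_
      rw [LinearMap.mem_ker, LinearMap.domRestrict_apply] at hv
      exact Subtype.ext (hBinj _ ((hNmem v).1 v.2).1 hv)
    rw [hk0, finrank_bot, add_zero] at h
    exact h
  have hNBle : N.map B ≤ LinearMap.range B := LinearMap.map_le_range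
  -- on `N`: `Y Y† (B v) = μ B v` and `Y X† (B v) = c B v`
  have hYYv : ∀ v ∈ N, Y (Ya (B v)) = μ • B v := by
    intro v hv
    have h := congrArg (fun T : Module.End ℂ W => T v) hYY
    simp only [LinearMap.add_apply, Module.End.mul_apply, LinearMap.smul_apply, ((hNmem v).1 hv).2, map_zero,
      add_zero] at h
    exact h
  have hXYv : ∀ v ∈ N, Y (Xa (B v)) = c • B v := by
    intro v hv
    have h := congrArg (fun T : Module.End ℂ W => T v) hXY
    simp only [LinearMap.add_apply, Module.End.mul_apply, LinearMap.smul_apply, ((hNmem v).1 hv).2, map_zero,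
      add_zero] at h
    exact h
  -- `μ ≠ 0`
  have hμ : μ ≠ 0 := by
    intro hμ0
    have hYaB : ∀ v ∈ N, Ya (B v) = 0 := by
      intro v hv
      have h0 : Y (Ya (B v)) = 0 := by rw [hYYv v hv, hμ0, zero_smul]
      refine hdefQ _ ((hQ _).2 (hΘYav _)) ?_
      rw [hYaY, h0, h0r]
    -- `B(N)` and `Y(U⁻)` meet non-trivially inside `B(W)`
    have hdim := Submodule.finrank_sup_add_finrank_inf_eq (N.map B) (Um.map Y)
    have hsup : Module.finrank ℂ ↥(N.map B ⊔ Um.map Y) ≤ Module.finrank ℂ (LinearMap.range B) :=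
      Submodule.finrank_mono (sup_le hNBle hVle)
    have hpos : 0 < Module.finrank ℂ ↥(N.map B ⊓ Um.map Y) := by omega
    obtain ⟨⟨p, hp⟩, hp0⟩ := Module.finrank_pos_iff_exists_ne_zero.1 hpos
    obtain ⟨hp1, hp2⟩ := Submodule.mem_inf.1 hp
    obtain ⟨v, hv, rfl⟩ := Submodule.mem_map.1 hp1
    obtain ⟨u, -, hu⟩ := Submodule.mem_map.1 hp2
    have hss : s (B v) (B v) = 0 := by
      rw [show s (B v) (B v) = s (Y u) (B v) by rw [hu], hYYa, hYaB v hv, h0r]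
    have hBv0 : B v = 0 := hdefP _ ((hP _).2 ((hPM _).1 (LinearMap.mem_range_self B v)).2) hss
    exact hp0 (Subtype.ext hBv0)
  -- `B(N) = Y(U⁻)`
  have hNB : N.map B = Um.map Y := by
    refine Submodule.eq_of_le_of_finrank_eq ?_ (by omega)
    rintro _ ⟨v, hv, rfl⟩
    have hιBv : ι (B v) = -(B v) := ((hPM _).1 (LinearMap.mem_range_self B v)).1
    have hmemU : Ya (B v) ∈ Um := (hUm _).2 (by rw [← hYaι, hιBv, map_neg])
    have h : B v = μ⁻¹ • Y (Ya (B v)) := by rw [hYYv v hv, smul_smul, inv_mul_cancel₀ hμ, one_smul]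
    rw [h]
    exact Submodule.smul_mem _ _ (Submodule.mem_map_of_mem hmemU)
  refine ⟨hμ, fun p hp => ?_, fun w hw => ?_⟩
  · rw [← hNB] at hp
    obtain ⟨v, hv, rfl⟩ := Submodule.mem_map.1 hp
    exact hXYv v hv
  · rw [hmapUp] at hw
    obtain ⟨u, hu, rfl⟩ := Submodule.mem_map.1 hw
    -- `Y X† B u ∈ Y(U⁻) = B(N)`
    have hιBu : ι (B u) = -(B u) := ((hPM _).1 (LinearMap.mem_range_self B u)).1
    have hmem : Y (Xa (B u)) ∈ N.map B := by
      rw [hNB]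
      exact Submodule.mem_map_of_mem ((hUm _).2 (by rw [← hXaι, hιBu, map_neg]))
    obtain ⟨n, hn, hn'⟩ := Submodule.mem_map.1 hmem
    obtain ⟨hnQU, hYn⟩ := (hNmem n).1 hn
    have h := congrArg (fun T : Module.End ℂ W => T u) hXY
    simp only [LinearMap.add_apply, Module.End.mul_apply, LinearMap.smul_apply] at h
    -- `B (X† Y u - c u + n) = 0` with the argument in `Q ∩ U⁺`
    have hιu := ((hQU u).1 hu).1
    have hXaYu : Xa (Y u) ∈ QU := (hQU _).2 ⟨by rw [← hXaι, ← hYι, hιu], hΘXav _⟩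
    have hw0 : Xa (Y u) - c • u + n = 0 := by
      refine hBinj _ (Submodule.add_mem _ (Submodule.sub_mem _ hXaYu (Submodule.smul_mem _ c hu)) hnQU) ?_
      rw [map_add, map_sub, map_smul, hn', ← h]
      abel
    have hXaYu' : Xa (Y u) = c • u - n := by
      rw [← sub_eq_zero]
      have : Xa (Y u) - (c • u - n) = Xa (Y u) - c • u + n := by abel
      rw [this, hw0]
    rw [hXaYu', map_sub, map_smul, hYn, sub_zero]

end HodgeStructure

end Literature.AlgebraicGeometry.Motives

end
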